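import Mathlib
import Summits.AnomalousDissipation.AnomalousDissipation.Theorems.SoloBlindTuningRigidity

/-!
# SoloBlind — the supercritical window of the two-parameter leaf map (paper §24.19 (f-ii), (f-v))

Companion to `SoloBlindMarginality` (N1: no leaf of a positive steady pattern is more than `4ε²`
supercritical) and `SoloBlindTuningRigidity` (window avoidance + no window jumping ⇒ fat block ⇒
mass floor).  This file supplies the bridge between the two: the hypothesis `OffWindow` of the
rigidity theorem FOLLOWS from marginality once the exact leaf exponent is, to within `η₁`, the value of
the explicit two-parameter leaf map

  `F(u, μ) = (1 + u) · g(μ / (1 + u))`,  `g(s) = σ₀ + b s − κ s²`  (`κ ≥ 0`),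

in the leaf-mean speed-up `u` and shear `μ = λ · (u_{j+1} − u_j)` (`λ = ⟨|V₀|²⟩ / h > 0`):
a band leaf (`σ₀ − K₀ ≥ η`) that is neither slowed (`u > −u_*`) nor sheared (`|μ| < m`) is
supercritical by more than `ε₂ + η₁` as soon as `σ₀ u_* + |b| m + 2κ m² + η₁ + ε₂ < η`, contradicting
marginality `σ_exact − K₀ ≤ ε₂` (`ε₂ = 4ε²`).  Hence `OffWindow u N u_* (m/λ)`, and with no window
jumping the fat block of `SoloBlindTuningRigidity.fat_block` follows (`fat_block_of_marginal`).
Also recorded: the window `{g > K₀}` is empty where `σ₀ − K₀ < −b²/(4κ)` (`window_empty`), which is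
why contacts lying outside `|x| ≲ .28` carry no width constraint (paper (f-v)).

All statements are elementary real inequalities; Mathlib only (plus the sibling rigidity file for the
corollary).
-/

namespace Summit.AnomalousDissipation.AnomalousDissipation.Theorems

/-- The two-parameter leaf map in (speed-up, shear) coordinates, written out:
`F(u, μ) = (1+u)σ₀ + bμ − κμ²/(1+u)` (`= (1+u)·g(μ/(1+u))` for `1+u ≠ 0`, `leafMap_eq_rescaled`). -/
noncomputable def leafMap (σ0 b κ u μ : ℝ) : ℝ := (1 + u) * σ0 + b * μ - κ * μ ^ 2 / (1 + u)

/-- `leafMap` is the time-rescaled sheared exponent `(1+u)·g(μ/(1+u))`. -/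
theorem leafMap_eq_rescaled (σ0 b κ u μ : ℝ) (hu : 1 + u ≠ 0) :
    leafMap σ0 b κ u μ = (1 + u) * (σ0 + b * (μ / (1 + u)) - κ * (μ / (1 + u)) ^ 2) := by
  unfold leafMap
  field_simp

/-- **Empty window.** Where the bare surplus is below `−b²/(4κ)`, no shear makes the leaf
supercritical: `g(μ) < K₀` for every `μ`. -/
theorem window_empty (σ0 b κ K0 μ : ℝ) (hκ : 0 < κ) (hS : σ0 - K0 < -(b ^ 2 / (4 * κ))) :
    σ0 + b * μ - κ * μ ^ 2 < K0 := by
  have hc : b ^ 2 / (4 * κ) = κ * (b / (2 * κ)) ^ 2 := by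
    field_simp
    ring
  have hsq : 0 ≤ κ * (μ - b / (2 * κ)) ^ 2 := mul_nonneg hκ.le (sq_nonneg _)
  have hexp : σ0 + b * μ - κ * μ ^ 2 = σ0 + κ * (b / (2 * κ)) ^ 2 - κ * (μ - b / (2 * κ)) ^ 2 := by
    field_simp
    ring
  rw [hexp]
  rw [hc] at hS
  linarith

/-- **Lower bound of the leaf map in the small-shear box.** For `σ₀, κ ≥ 0`, `−min(u_*, 1/2) < u`
(precisely: `−u_* < u` and `−1/2 ≤ u`) and `|μ| < m`:
`F(u, μ) ≥ σ₀ − σ₀u_* − |b|m − 2κm²`. -/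
theorem leafMap_lower (σ0 b κ u μ us m : ℝ) (hσ0 : 0 ≤ σ0) (hκ : 0 ≤ κ) (hus : -us < u)
    (hu : -(1 / 2 : ℝ) ≤ u) (hμ : |μ| < m) :
    σ0 - σ0 * us - |b| * m - 2 * κ * m ^ 2 ≤ leafMap σ0 b κ u μ := by
  unfold leafMap
  have hpos : 0 < 1 + u := by linarith
  have hm : 0 ≤ m := le_trans (abs_nonneg μ) hμ.le
  -- (1+u)σ₀ ≥ (1 − u_*)σ₀
  have h1 : σ0 - σ0 * us ≤ (1 + u) * σ0 := by nlinarith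
  -- bμ ≥ −|b| m
  have h2 : -(|b| * m) ≤ b * μ := by
    have h21 : -(|b| * |μ|) ≤ b * μ := by
      rw [← abs_mul]
      exact neg_abs_le _
    have h22 : |b| * |μ| ≤ |b| * m := mul_le_mul_of_nonneg_left hμ.le (abs_nonneg b)
    linarith
  -- κμ²/(1+u) ≤ 2κm²
  have hμ2 : μ ^ 2 ≤ m ^ 2 := by
    have := abs_lt.mp hμ
    nlinarith [sq_nonneg (m - |μ|), abs_nonneg μ, sq_abs μ]
  have h3 : κ * μ ^ 2 / (1 + u) ≤ 2 * κ * m ^ 2 := by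
    rw [div_le_iff₀ hpos]
    have hk1 : κ * μ ^ 2 ≤ κ * m ^ 2 := mul_le_mul_of_nonneg_left hμ2 hκ
    have hk2 : 0 ≤ κ * m ^ 2 := mul_nonneg hκ (sq_nonneg m)
    nlinarith
  linarith

/-- **Window avoidance from marginality.** Leaves `0 … N−1` of the band (`σ₀ⱼ − K₀ ≥ η`), with the
exact exponent `σexⱼ` within `η₁` of the two-parameter leaf map at the leaf-mean speed-up `uⱼ ≥ −1/2`
and shear `μⱼ = λ·(uⱼ₊₁ − uⱼ)` (`λ > 0`), and marginal (`σexⱼ − K₀ ≤ ε₂`, N1 of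
`SoloBlindMarginality.marginality_pointwise` with `ε₂ = 4ε²`): if
`σ₀ⱼu_* + |bⱼ|m + 2κⱼm² + η₁ + ε₂ < η` on the band, then every leaf that is not slowed below `−u_*`
carries a step of size at least `m/λ` — `OffWindow u N u_* (m/λ)`. -/
theorem offWindow_of_marginal (u μ σex σ0 b κ : ℕ → ℝ) (N : ℕ) (K0 η η1 ε2 us m lam : ℝ)
    (hlam : 0 < lam)
    (hμ : ∀ j, j < N → μ j = lam * leafStep u j)
    (hband : ∀ j, j < N → η ≤ σ0 j - K0) (hσ0 : ∀ j, j < N → 0 ≤ σ0 j)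
    (hκ : ∀ j, j < N → 0 ≤ κ j) (hu : ∀ j, j < N → -(1 / 2 : ℝ) ≤ u j)
    (hloc : ∀ j, j < N → |σex j - leafMap (σ0 j) (b j) (κ j) (u j) (μ j)| ≤ η1)
    (hmarg : ∀ j, j < N → σex j - K0 ≤ ε2)
    (hsmall : ∀ j, j < N → σ0 j * us + |b j| * m + 2 * κ j * m ^ 2 + η1 + ε2 < η) :
    OffWindow u N us (m / lam) := by
  intro j hj hus
  by_contra hcon
  rw [not_or, not_le, not_le] at hcon
  obtain ⟨hlt, hgt⟩ := hcon
  -- the step is inside (−m/λ, m/λ), so the shear is inside (−m, m)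
  have hstep : |leafStep u j| < m / lam := abs_lt.mpr ⟨by linarith, hlt⟩
  have hμm : |μ j| < m := by
    rw [hμ j hj, abs_mul, abs_of_pos hlam]
    calc lam * |leafStep u j| < lam * (m / lam) := mul_lt_mul_of_pos_left hstep hlam
      _ = m := by field_simp
  have hF := leafMap_lower (σ0 j) (b j) (κ j) (u j) (μ j) us m (hσ0 j hj) (hκ j hj) hus (hu j hj) hμm
  have hl := hloc j hj
  have hl' := (abs_le.mp hl).1
  have hb := hband j hj
  have hs := hsmall j hj
  have hmg := hmarg j hj
  linarith

/-- **Fat block from marginality** (composition with `SoloBlindTuningRigidity.fat_block`): under the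
hypotheses of `offWindow_of_marginal`, no window jumping at step resolution `m/λ` and `m > 0`, there is
a block of consecutive leaves of length `L` with `3L + 2⌈2u_*λ/m⌉ ≥ N + 1` on which the speed-up is a
fat jet (`u ≥ u_*`) or a fat slow-down (`u ≤ −u_*`) — the input of the tested-balance mass floor
`mass_floor_of_fat_run`. -/
theorem fat_block_of_marginal (u μ σex σ0 b κ : ℕ → ℝ) (N : ℕ) (K0 η η1 ε2 us m lam : ℝ)
    (hlam : 0 < lam) (hm : 0 < m)
    (hμ : ∀ j, j < N → μ j = lam * leafStep u j)
    (hband : ∀ j, j < N → η ≤ σ0 j - K0) (hσ0 : ∀ j, j < N → 0 ≤ σ0 j)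
    (hκ : ∀ j, j < N → 0 ≤ κ j) (hu : ∀ j, j < N → -(1 / 2 : ℝ) ≤ u j)
    (hloc : ∀ j, j < N → |σex j - leafMap (σ0 j) (b j) (κ j) (u j) (μ j)| ≤ η1)
    (hmarg : ∀ j, j < N → σex j - K0 ≤ ε2)
    (hsmall : ∀ j, j < N → σ0 j * us + |b j| * m + 2 * κ j * m ^ 2 + η1 + ε2 < η)
    (hC : NoWindowJump u N (m / lam)) :
    ∃ a L : ℕ, a + L ≤ N + 1 ∧ ((N : ℝ) + 1 ≤ 3 * L + 2 * (⌈2 * us / (m / lam)⌉₊ : ℕ)) ∧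
      ((∀ j, a ≤ j → j < a + L → us ≤ u j) ∨ (∀ j, a ≤ j → j < a + L → u j ≤ -us)) :=
  fat_block (offWindow_of_marginal u μ σex σ0 b κ N K0 η η1 ε2 us m lam hlam hμ hband hσ0 hκ hu hloc
    hmarg hsmall) hC (div_pos hm hlam)

end Summit.AnomalousDissipation.AnomalousDissipation.Theorems
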